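import Literature.NumberTheory.LFunctions.Zhang2022.DetectorDoublingClamped

/-!
# The doubling identity (K2 / D1), part C: integration by parts and the identity

Sub-cell E of the `landau-siegel` programme, row S-E-p5-12 (E-102 head 2, KERNEL PLAN OF RECORD = DOUBLING,
ls-barrier-plan g1 2026-08-27T01:45:23Z / 01:54:52Z; statement shapes = ls-barrier-num g2's ShadowKernelSketch
1268210b689bb6c5; proof skeleton = ls-barrier-num g2 2026-08-27T01:53:01Z; symbolic confirmation kit j265090/j265247,
float check `k2_float_check.py`). ORIENTATION (planner ruling (3)): PERIODIC — the Euler–Lagrange extremal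
`F = γ₀ + Σ_m γ_(m+1) e^(−iπ b_m t)` of the bulk form on `[0,1]`, CLAMPED at `t = 0`, with data `(F, F′)(1) = (x₁, x₂)`.

This file (part C) proves **THE DOUBLING IDENTITY (K2 / D1)** as a kernel theorem:

* `Det.bulkFormOn_extremal_eq_jetBracket` — INTEGRATION BY PARTS: for every exponential extremal `F = extremal b γ`
  (any `γ`), `bulkFormOn b 0 1 F F′ F″ = Re J(1) − Re J(0)` with the boundary jet bracket
  `J = conj(F′)(F″ + (iπe₁/2)F′) + conj(F)(−F‴ − iπe₁F″ + π²e₂F′ + (iπ³e₃/2)F)` (`Det.jetBracket`); ingredients: the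
  mode-by-mode Euler–Lagrange equation `F⁗ + iπe₁F‴ − π²e₂F″ − iπ³e₃F′ = 0` (`Det.extremal_euler_lagrange`: the bulk
  symbol vanishes at the frequencies `0, −b_m`), `HasDerivAt` of `F, F′, F″, F‴, J`, and the FTC on `[0,1]`;
* `Det.doublingIdentity_clamped` — for pairwise-distinct `b` with `Q ≠ 0` (⟺ `c₀ ≠ 0`) and all data `x = (x₁, x₂)`:
  `(Re A₀)·bulkFormOn b 0 1 F⋆_x F⋆_x′ F⋆_x″ = freeEndForm b x₁ x₂`, i.e. Zhang's free-end boundary form IS `c₀` times the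
  bulk energy of the extremal continuation CLAMPED at `t = 0` with data `x` at `t = 1` (periodic orientation, planner ruling
  (3)); assembled from part B's boundary conditions and jet map. This is (D1) of ls-barrier-num's H-CLOSED-FORM §10 /
  ls-theory's «Id-4» (numerically exact 8/8 + 5/5, CAS-exact j264709/j265007/j265090), the identity that turns the one-sided
  form `(π/2)·𝔅_b(g) = c₀·T^([0,1])(S) + x*·Bdm·x` (K1, `DetectorShiftClosedForm`) into `c₀·T` on the DOUBLED interval
  (K3 Parseval ⇒ E-010(ii) for every sign-admissible `b`, K6).
Nothing here asserts anything about `L`-functions. -/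


noncomputable section

open Complex Real ComplexConjugate

namespace Literature.NumberTheory.LFunctions.Zhang2022

namespace Det

/-- `(−iπz)² = −π²z²`. [folklore] -/
private theorem negIpi_sq' (z : ℂ) : (-(I * (π : ℂ) * z)) ^ 2 = -((π : ℂ) ^ 2 * z ^ 2) := by
  have : I ^ 2 = -1 := Complex.I_sq
  linear_combination ((π : ℂ) ^ 2 * z ^ 2) * this

/-- `(−iπz)³ = iπ³z³`. [folklore] -/
private theorem negIpi_cube' (z : ℂ) : (-(I * (π : ℂ) * z)) ^ 3 = I * ((π : ℂ) ^ 3 * z ^ 3) := by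
  have : I ^ 2 = -1 := Complex.I_sq
  linear_combination (-(I * (π : ℂ) ^ 3 * z ^ 3)) * this

/-! ### Stage 2: the bulk energy of an exponential extremal is a boundary jet bracket (integration by parts) -/

section ByParts

variable (b : Fin 3 → ℝ) (γ : Fin 4 → ℂ)

/-- The fourth derivative `F⁗`. [cite: Zhang2022LandauSiegel, §7 Prop. 7.1 p.44] -/
def extremalDDDD (b : Fin 3 → ℝ) (γ : Fin 4 → ℂ) (t : ℝ) : ℂ :=
  ∑ m : Fin 3, γ m.succ * (-(I * π * (b m : ℂ))) ^ 4 * cexp (-(I * π * (b m : ℂ) * t))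

/-- Derivative of one exponential mode `t ↦ e^(−iπ b_m t)`. [folklore] -/
private theorem hasDerivAt_mode (m : Fin 3) (t : ℝ) :
    HasDerivAt (fun s : ℝ => cexp (-(I * π * (b m : ℂ) * s)))
      ((-(I * π * (b m : ℂ))) * cexp (-(I * π * (b m : ℂ) * t))) t := by
  have hc : HasDerivAt (fun y : ℝ => cexp (-(I * π * (b m : ℂ)) * ((id y : ℝ) : ℂ)))
      (cexp (-(I * π * (b m : ℂ)) * ((id t : ℝ) : ℂ)) * (-(I * π * (b m : ℂ)) * ((1 : ℝ) : ℂ))) t :=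
    (((hasDerivAt_id t).ofReal_comp).const_mul _).cexp
  have e1 : (fun s : ℝ => cexp (-(I * π * (b m : ℂ) * s))) =
      (fun y : ℝ => cexp (-(I * π * (b m : ℂ)) * ((id y : ℝ) : ℂ))) := by
    funext s; simp only [id, neg_mul]
  rw [e1]
  convert hc using 1
  simp only [id, Complex.ofReal_one, mul_one, neg_mul]
  ring

/-- Derivative of a mode with a polynomial weight: `t ↦ c·λ^k·e^(λt)` has derivative `c·λ^(k+1)·e^(λt)`. [folklore] -/
private theorem hasDerivAt_mode_pow (m : Fin 3) (c : ℂ) (k : ℕ) (t : ℝ) :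
    HasDerivAt (fun s : ℝ => c * (-(I * π * (b m : ℂ))) ^ k * cexp (-(I * π * (b m : ℂ) * s)))
      (c * (-(I * π * (b m : ℂ))) ^ (k + 1) * cexp (-(I * π * (b m : ℂ) * t))) t := by
  have h := (hasDerivAt_mode b m t).const_mul (c * (-(I * π * (b m : ℂ))) ^ k)
  have e1 : (fun s : ℝ => c * (-(I * π * (b m : ℂ))) ^ k * cexp (-(I * π * (b m : ℂ) * s))) =
      (fun s : ℝ => c * (-(I * π * (b m : ℂ))) ^ k * (cexp (-(I * π * (b m : ℂ) * s)))) := rfl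
  rw [e1]
  exact h.congr_deriv (by ring)

/-- `F′` is the derivative of `F`. [cite: Zhang2022LandauSiegel, §7 Prop. 7.1 p.44] -/
theorem hasDerivAt_extremal (t : ℝ) : HasDerivAt (extremal b γ) (extremalD b γ t) t := by
  have hs := HasDerivAt.fun_sum (u := Finset.univ)
    (fun (m : Fin 3) _ => hasDerivAt_mode_pow b m (γ m.succ) 0 t)
  have h := hs.const_add (γ 0)
  have h' : HasDerivAt (extremal b γ)
      (∑ i ∈ Finset.univ, γ (Fin.succ i) * (-(I * π * (b i : ℂ))) ^ (0 + 1) * cexp (-(I * π * (b i : ℂ) * t))) t := by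
    refine h.congr_of_eventuallyEq (Filter.Eventually.of_forall fun s => ?_)
    simp only [extremal, pow_zero, mul_one]
  refine h'.congr_deriv ?_
  simp only [extremalD, zero_add, pow_one]

/-- `F″` is the derivative of `F′`. [cite: Zhang2022LandauSiegel, §7 Prop. 7.1 p.44] -/
theorem hasDerivAt_extremalD (t : ℝ) : HasDerivAt (extremalD b γ) (extremalDD b γ t) t := by
  have hs := HasDerivAt.fun_sum (u := Finset.univ)
    (fun (m : Fin 3) _ => hasDerivAt_mode_pow b m (γ m.succ) 1 t)
  have h' : HasDerivAt (extremalD b γ)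
      (∑ i ∈ Finset.univ, γ (Fin.succ i) * (-(I * π * (b i : ℂ))) ^ (1 + 1) * cexp (-(I * π * (b i : ℂ) * t))) t := by
    refine hs.congr_of_eventuallyEq (Filter.Eventually.of_forall fun s => ?_)
    simp only [extremalD, pow_one]
  refine h'.congr_deriv ?_
  simp only [extremalDD, Nat.reduceAdd]

/-- `F‴` is the derivative of `F″`. [cite: Zhang2022LandauSiegel, §7 Prop. 7.1 p.44] -/
theorem hasDerivAt_extremalDD (t : ℝ) : HasDerivAt (extremalDD b γ) (extremalDDD b γ t) t := by
  have hs := HasDerivAt.fun_sum (u := Finset.univ)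
    (fun (m : Fin 3) _ => hasDerivAt_mode_pow b m (γ m.succ) 2 t)
  have h' : HasDerivAt (extremalDD b γ)
      (∑ i ∈ Finset.univ, γ (Fin.succ i) * (-(I * π * (b i : ℂ))) ^ (2 + 1) * cexp (-(I * π * (b i : ℂ) * t))) t := by
    refine hs.congr_of_eventuallyEq (Filter.Eventually.of_forall fun s => ?_)
    simp only [extremalDD]
  refine h'.congr_deriv ?_
  simp only [extremalDDD, Nat.reduceAdd]

/-- `F⁗` is the derivative of `F‴`. [cite: Zhang2022LandauSiegel, §7 Prop. 7.1 p.44] -/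
theorem hasDerivAt_extremalDDD (t : ℝ) : HasDerivAt (extremalDDD b γ) (extremalDDDD b γ t) t := by
  have hs := HasDerivAt.fun_sum (u := Finset.univ)
    (fun (m : Fin 3) _ => hasDerivAt_mode_pow b m (γ m.succ) 3 t)
  have h' : HasDerivAt (extremalDDD b γ)
      (∑ i ∈ Finset.univ, γ (Fin.succ i) * (-(I * π * (b i : ℂ))) ^ (3 + 1) * cexp (-(I * π * (b i : ℂ) * t))) t := by
    refine hs.congr_of_eventuallyEq (Filter.Eventually.of_forall fun s => ?_)
    simp only [extremalDDD]
  refine h'.congr_deriv ?_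
  simp only [extremalDDDD, Nat.reduceAdd]

/-- `(−iπz)⁴ = π⁴z⁴`. [folklore] -/
private theorem negIpi_four (z : ℂ) : (-(I * (π : ℂ) * z)) ^ 4 = (π : ℂ) ^ 4 * z ^ 4 := by
  have : I ^ 2 = -1 := Complex.I_sq
  linear_combination ((π : ℂ) ^ 4 * z ^ 4 * (I ^ 2 - 1)) * this

/-- **The Euler–Lagrange equation holds mode by mode**: `F⁗ + iπe₁F‴ − π²e₂F″ − iπ³e₃F′ = 0` (the bulk symbol
`λ(λ+b₀)(λ+b₁)(λ+b₂)` vanishes at the frequencies `0, −b_m`). [cite: Zhang2022LandauSiegel, §7 Prop. 7.1 p.44] -/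
theorem extremal_euler_lagrange (t : ℝ) :
    extremalDDDD b γ t + I * π * ((b 0 + b 1 + b 2 : ℝ) : ℂ) * extremalDDD b γ t
      - (π : ℂ) ^ 2 * ((b 0 * b 1 + b 1 * b 2 + b 2 * b 0 : ℝ) : ℂ) * extremalDD b γ t
      - I * (π : ℂ) ^ 3 * ((b 0 * b 1 * b 2 : ℝ) : ℂ) * extremalD b γ t = 0 := by
  unfold extremalDDDD extremalDDD extremalDD extremalD
  simp only [Fin.sum_univ_three, negIpi_sq', negIpi_cube', negIpi_four]
  push_cast
  ring_nf
  simp only [Complex.I_sq]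
  ring_nf

/-- The boundary JET BRACKET `J(t) = conj(F′)(F″ + (iπe₁/2)F′) + conj(F)(−F‴ − iπe₁F″ + π²e₂F′ + (iπ³e₃/2)F)`.
[cite: Zhang2022LandauSiegel, §7 Prop. 7.1 p.44; §2 (2.32)–(2.33)] -/
def jetBracket (b : Fin 3 → ℝ) (γ : Fin 4 → ℂ) (t : ℝ) : ℂ :=
  conj (extremalD b γ t) * (extremalDD b γ t + I * π * ((b 0 + b 1 + b 2 : ℝ) : ℂ) / 2 * extremalD b γ t)
    + conj (extremal b γ t) * (-extremalDDD b γ t - I * π * ((b 0 + b 1 + b 2 : ℝ) : ℂ) * extremalDD b γ t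
        + (π : ℂ) ^ 2 * ((b 0 * b 1 + b 1 * b 2 + b 2 * b 0 : ℝ) : ℂ) * extremalD b γ t
        + I * (π : ℂ) ^ 3 * ((b 0 * b 1 * b 2 : ℝ) : ℂ) / 2 * extremal b γ t)

/-- The derivative of the jet bracket (product rule, before using Euler–Lagrange). [cite: Zhang2022LandauSiegel, §7 Prop. 7.1 p.44] -/
def jetBracketD (b : Fin 3 → ℝ) (γ : Fin 4 → ℂ) (t : ℝ) : ℂ :=
  conj (extremalDD b γ t) * (extremalDD b γ t + I * π * ((b 0 + b 1 + b 2 : ℝ) : ℂ) / 2 * extremalD b γ t)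
    + conj (extremalD b γ t) * (extremalDDD b γ t + I * π * ((b 0 + b 1 + b 2 : ℝ) : ℂ) / 2 * extremalDD b γ t)
    + (conj (extremalD b γ t) * (-extremalDDD b γ t - I * π * ((b 0 + b 1 + b 2 : ℝ) : ℂ) * extremalDD b γ t
        + (π : ℂ) ^ 2 * ((b 0 * b 1 + b 1 * b 2 + b 2 * b 0 : ℝ) : ℂ) * extremalD b γ t
        + I * (π : ℂ) ^ 3 * ((b 0 * b 1 * b 2 : ℝ) : ℂ) / 2 * extremal b γ t)
      + conj (extremal b γ t) * (-extremalDDDD b γ t - I * π * ((b 0 + b 1 + b 2 : ℝ) : ℂ) * extremalDDD b γ t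
        + (π : ℂ) ^ 2 * ((b 0 * b 1 + b 1 * b 2 + b 2 * b 0 : ℝ) : ℂ) * extremalDD b γ t
        + I * (π : ℂ) ^ 3 * ((b 0 * b 1 * b 2 : ℝ) : ℂ) / 2 * extremalD b γ t))

/-- `J′ = jetBracketD`. [cite: Zhang2022LandauSiegel, §7 Prop. 7.1 p.44] -/
theorem hasDerivAt_jetBracket (t : ℝ) : HasDerivAt (jetBracket b γ) (jetBracketD b γ t) t := by
  have h0 := hasDerivAt_extremal b γ t
  have h1 := hasDerivAt_extremalD b γ t
  have h2 := hasDerivAt_extremalDD b γ t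
  have h3 := hasDerivAt_extremalDDD b γ t
  have h0c : HasDerivAt (fun s => conj (extremal b γ s)) (conj (extremalD b γ t)) t := h0.star
  have h1c : HasDerivAt (fun s => conj (extremalD b γ s)) (conj (extremalDD b γ t)) t := h1.star
  have hA := h1c.mul (h2.add (h1.const_mul (I * π * ((b 0 + b 1 + b 2 : ℝ) : ℂ) / 2)))
  have hB := h0c.mul (((h3.neg.sub (h2.const_mul (I * π * ((b 0 + b 1 + b 2 : ℝ) : ℂ)))).add
    (h1.const_mul ((π : ℂ) ^ 2 * ((b 0 * b 1 + b 1 * b 2 + b 2 * b 0 : ℝ) : ℂ)))).add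
    (h0.const_mul (I * (π : ℂ) ^ 3 * ((b 0 * b 1 * b 2 : ℝ) : ℂ) / 2)))
  have h := hA.add hB
  have h' : HasDerivAt (jetBracket b γ) _ t :=
    h.congr_of_eventuallyEq (Filter.Eventually.of_forall fun s => by
      simp only [jetBracket, Pi.add_apply, Pi.mul_apply, Pi.neg_apply, Pi.sub_apply])
  refine h'.congr_deriv ?_
  simp only [jetBracketD, Pi.add_apply, Pi.neg_apply, Pi.sub_apply]

/-- Pointwise algebra behind the by-parts identity (with `F⁗` already eliminated by Euler–Lagrange). [folklore] -/
private theorem density_re_aux (e₁ e₂ e₃ : ℝ) (w₀ w₁ w₂ w₃ : ℂ) :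
    ‖w₂‖ ^ 2 + π * e₁ * (w₂ * conj w₁).im + π ^ 2 * e₂ * ‖w₁‖ ^ 2 + π ^ 3 * e₃ * (w₁ * conj w₀).im =
      (conj w₂ * (w₂ + I * π * (e₁ : ℂ) / 2 * w₁) + conj w₁ * (w₃ + I * π * (e₁ : ℂ) / 2 * w₂)
        + (conj w₁ * (-w₃ - I * π * (e₁ : ℂ) * w₂ + (π : ℂ) ^ 2 * (e₂ : ℂ) * w₁ + I * (π : ℂ) ^ 3 * (e₃ : ℂ) / 2 * w₀)
          + conj w₀ * (-(-(I * π * (e₁ : ℂ) * w₃) + (π : ℂ) ^ 2 * (e₂ : ℂ) * w₂ + I * (π : ℂ) ^ 3 * (e₃ : ℂ) * w₁)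
              - I * π * (e₁ : ℂ) * w₃ + (π : ℂ) ^ 2 * (e₂ : ℂ) * w₂ + I * (π : ℂ) ^ 3 * (e₃ : ℂ) / 2 * w₁))).re := by
  rw [Complex.sq_norm, Complex.sq_norm, Complex.normSq_apply, Complex.normSq_apply]
  simp only [pow_succ, pow_zero, one_mul, Complex.add_re, Complex.sub_re, Complex.neg_re, Complex.mul_re,
    Complex.mul_im, Complex.add_im, Complex.sub_im, Complex.neg_im, Complex.conj_re, Complex.conj_im, Complex.I_re,
    Complex.I_im, Complex.ofReal_re, Complex.ofReal_im, Complex.div_ofNat_re, Complex.div_ofNat_im]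
  ring

/-- The bulk density is the real part of `J′` (Euler–Lagrange eliminates `F⁗`). [cite: Zhang2022LandauSiegel, §7 Prop. 7.1 p.44] -/
theorem bulkDensity_eq_re_jetBracketD (t : ℝ) :
    ‖extremalDD b γ t‖ ^ 2 + π * (b 0 + b 1 + b 2) * (extremalDD b γ t * conj (extremalD b γ t)).im
      + π ^ 2 * (b 0 * b 1 + b 1 * b 2 + b 2 * b 0) * ‖extremalD b γ t‖ ^ 2
      + π ^ 3 * (b 0 * b 1 * b 2) * (extremalD b γ t * conj (extremal b γ t)).im
      = (jetBracketD b γ t).re := by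
  have hEL := extremal_euler_lagrange b γ t
  have h4 : extremalDDDD b γ t = -(I * π * ((b 0 + b 1 + b 2 : ℝ) : ℂ) * extremalDDD b γ t)
      + (π : ℂ) ^ 2 * ((b 0 * b 1 + b 1 * b 2 + b 2 * b 0 : ℝ) : ℂ) * extremalDD b γ t
      + I * (π : ℂ) ^ 3 * ((b 0 * b 1 * b 2 : ℝ) : ℂ) * extremalD b γ t := by
    linear_combination hEL
  unfold jetBracketD
  rw [h4]
  exact density_re_aux (b 0 + b 1 + b 2) (b 0 * b 1 + b 1 * b 2 + b 2 * b 0) (b 0 * b 1 * b 2)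
    (extremal b γ t) (extremalD b γ t) (extremalDD b γ t) (extremalDDD b γ t)

/-- **INTEGRATION BY PARTS (K2, Stage 2)**: the bulk energy on `[0,1]` of an exponential extremal is the boundary
jet bracket: `T_b^([0,1])(F) = Re J(1) − Re J(0)`. [cite: Zhang2022LandauSiegel, §7 Prop. 7.1 p.44; §2 (2.32)–(2.33)] -/
theorem bulkFormOn_extremal_eq_jetBracket :
    bulkFormOn b 0 1 (extremal b γ) (extremalD b γ) (extremalDD b γ)
      = (jetBracket b γ 1).re - (jetBracket b γ 0).re := by
  unfold bulkFormOn
  have hderiv : ∀ t ∈ Set.uIcc (0 : ℝ) 1, HasDerivAt (fun s => (jetBracket b γ s).re) ((jetBracketD b γ t).re) t := by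
    intro t _
    have := (hasDerivAt_jetBracket b γ t)
    exact Complex.reCLM.hasFDerivAt.comp_hasDerivAt t this
  have hcontD : Continuous (fun t => (jetBracketD b γ t).re) := by
    have hm : ∀ (m : Fin 3) (k : ℕ) (c : ℂ), Continuous (fun s : ℝ => c * (-(I * π * (b m : ℂ))) ^ k *
        cexp (-(I * π * (b m : ℂ) * s))) := by
      intro m k c
      exact continuous_const.mul (Complex.continuous_exp.comp
        ((continuous_const.mul Complex.continuous_ofReal).neg))
    have hF : Continuous (extremal b γ) := by
      unfold extremal
      exact continuous_const.add (continuous_finsetSum _ (fun m _ => by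
        simpa only [pow_zero, mul_one] using hm m 0 (γ m.succ)))
    have hF1 : Continuous (extremalD b γ) := by
      unfold extremalD; exact continuous_finsetSum _ (fun m _ => by simpa only [pow_one] using hm m 1 (γ m.succ))
    have hF2 : Continuous (extremalDD b γ) := by
      unfold extremalDD; exact continuous_finsetSum _ (fun m _ => hm m 2 (γ m.succ))
    have hF3 : Continuous (extremalDDD b γ) := by
      unfold extremalDDD; exact continuous_finsetSum _ (fun m _ => hm m 3 (γ m.succ))
    have hF4 : Continuous (extremalDDDD b γ) := by
      unfold extremalDDDD; exact continuous_finsetSum _ (fun m _ => hm m 4 (γ m.succ))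
    have hJ : Continuous (jetBracketD b γ) := by
      unfold jetBracketD
      fun_prop
    exact Complex.continuous_re.comp hJ
  rw [← intervalIntegral.integral_eq_sub_of_hasDerivAt hderiv (hcontD.intervalIntegrable 0 1)]
  refine intervalIntegral.integral_congr (fun t _ => ?_)
  exact bulkDensity_eq_re_jetBracketD b γ t

end ByParts

/-! ### Stage 3: the doubling identity for the clamped extremal -/

section Doubling

variable (b : Fin 3 → ℝ) (x₁ x₂ : ℂ)

/-- Pointwise algebra of the assembly: the real part of the jet bracket at the data end against `freeEndForm`. [folklore] -/
private theorem assembly_aux (aN : ℂ) (a0re a0im abim e₁ e₂ e₃ : ℝ) (x₁ x₂ : ℂ) :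
    2 * (-(a0im / 2) * (π ^ 3 * e₃ * ‖x₁‖ ^ 2 + π * e₁ * ‖x₂‖ ^ 2) + π * abim * ‖x₂‖ ^ 2
        + π ^ 2 * (aN * x₂ * conj x₁).re) =
      (conj x₂ * ((π : ℂ) ^ 2 * conj aN * x₁ +
            (2 * (π : ℂ) * (abim : ℂ) - (π : ℂ) * (e₁ : ℂ) * (a0im : ℂ) - I * (π : ℂ) * (e₁ : ℂ) * (a0re : ℂ)) * x₂ +
            I * π * (e₁ : ℂ) * (a0re : ℂ) * x₂) +
        conj x₁ * (-(((π : ℂ) ^ 3 * (e₃ : ℂ) * (a0im : ℂ) + I * (π : ℂ) ^ 3 * (e₃ : ℂ) * (a0re : ℂ)) * x₁ +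
              (2 * (π : ℂ) ^ 2 * (e₂ : ℂ) * (a0re : ℂ) - (π : ℂ) ^ 2 * aN) * x₂) +
            2 * (a0re : ℂ) * (π : ℂ) ^ 2 * (e₂ : ℂ) * x₂ + I * (π : ℂ) ^ 3 * (e₃ : ℂ) * (a0re : ℂ) * x₁)).re := by
  rw [Complex.sq_norm, Complex.sq_norm, Complex.normSq_apply, Complex.normSq_apply]
  simp only [pow_succ, pow_zero, one_mul, Complex.add_re, Complex.sub_re, Complex.neg_re, Complex.mul_re,
    Complex.mul_im, Complex.add_im, Complex.sub_im, Complex.neg_im, Complex.conj_re, Complex.conj_im, Complex.I_re,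
    Complex.I_im, Complex.ofReal_re, Complex.ofReal_im, Complex.re_ofNat, Complex.im_ofNat]
  ring

/-- **THE DOUBLING IDENTITY (K2 / D1), periodic orientation, clamped extremal with explicit data**: for pairwise
distinct `b` with `Q(b,u) ≠ 0` (⟺ `c₀(b) ≠ 0`) and every `x = (x₁, x₂)`, the exponential extremal `F⋆_x` CLAMPED at
`t = 0` with `(F⋆, F⋆′)(1) = (x₁, x₂)` satisfies `c₀(b)·T_b^([0,1])(F⋆_x) = freeEndForm b x₁ x₂` — Zhang's free-end
boundary form is `c₀` times the clamped bulk energy (ls-barrier-num H-CLOSED-FORM §10 (D1), ls-theory «Id-4»; numerically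
and CAS exact; here a kernel theorem). [cite: Zhang2022LandauSiegel, §2 (2.32)–(2.33); §7 Prop. 7.1 p.44; §8 (8.11)–(8.18)] -/
theorem doublingIdentity_clamped (h01 : b 0 ≠ b 1) (h02 : b 0 ≠ b 2) (h12 : b 1 ≠ b 2) (hQ : dblQ b ≠ 0) :
    (atomA0 b).re *
        bulkFormOn b 0 1 (extremal b (clampedCoeff b x₁ x₂)) (extremalD b (clampedCoeff b x₁ x₂))
          (extremalDD b (clampedCoeff b x₁ x₂)) = freeEndForm b x₁ x₂ := by
  rw [bulkFormOn_extremal_eq_jetBracket]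
  have hJ0 : jetBracket b (clampedCoeff b x₁ x₂) 0 = 0 := by
    unfold jetBracket
    rw [clampedExt_zero b x₁ x₂ hQ, clampedExtD_zero b x₁ x₂ hQ]
    simp
  have h2 := clampedExtDD_one b x₁ x₂ h01 h02 h12 hQ
  have h3 := clampedExtDDD_one b x₁ x₂ h01 h02 h12 hQ
  have hE : 2 * ((atomA0 b).re : ℂ) * jetBracket b (clampedCoeff b x₁ x₂) 1 =
      conj x₂ * ((π : ℂ) ^ 2 * conj (atomAN b) * x₁ +
            (2 * (π : ℂ) * ((atomAb b).im : ℂ) - (π : ℂ) * ((b 0 + b 1 + b 2 : ℝ) : ℂ) * ((atomA0 b).im : ℂ) -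
              I * (π : ℂ) * ((b 0 + b 1 + b 2 : ℝ) : ℂ) * ((atomA0 b).re : ℂ)) * x₂ +
            I * π * ((b 0 + b 1 + b 2 : ℝ) : ℂ) * ((atomA0 b).re : ℂ) * x₂) +
        conj x₁ * (-(((π : ℂ) ^ 3 * ((b 0 * b 1 * b 2 : ℝ) : ℂ) * ((atomA0 b).im : ℂ) +
                I * (π : ℂ) ^ 3 * ((b 0 * b 1 * b 2 : ℝ) : ℂ) * ((atomA0 b).re : ℂ)) * x₁ +
              (2 * (π : ℂ) ^ 2 * ((b 0 * b 1 + b 1 * b 2 + b 2 * b 0 : ℝ) : ℂ) * ((atomA0 b).re : ℂ) -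
                (π : ℂ) ^ 2 * atomAN b) * x₂) +
            2 * ((atomA0 b).re : ℂ) * (π : ℂ) ^ 2 * ((b 0 * b 1 + b 1 * b 2 + b 2 * b 0 : ℝ) : ℂ) * x₂ +
            I * (π : ℂ) ^ 3 * ((b 0 * b 1 * b 2 : ℝ) : ℂ) * ((atomA0 b).re : ℂ) * x₁) := by
    unfold jetBracket
    rw [clampedExt_one b x₁ x₂ hQ, clampedExtD_one b x₁ x₂ hQ]
    linear_combination (conj x₂) * h2 - (conj x₁) * h3
  have hre : 2 * ((atomA0 b).re * (jetBracket b (clampedCoeff b x₁ x₂) 1).re) =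
      (2 * ((atomA0 b).re : ℂ) * jetBracket b (clampedCoeff b x₁ x₂) 1).re := by
    simp only [Complex.mul_re, Complex.mul_im, Complex.ofReal_re, Complex.ofReal_im, Complex.re_ofNat, Complex.im_ofNat]
    ring
  rw [hJ0, Complex.zero_re, sub_zero]
  have key := assembly_aux (atomAN b) (atomA0 b).re (atomA0 b).im (atomAb b).im (b 0 + b 1 + b 2)
    (b 0 * b 1 + b 1 * b 2 + b 2 * b 0) (b 0 * b 1 * b 2) x₁ x₂
  rw [← hE, ← hre] at key
  unfold freeEndForm
  linarith

end Doubling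

/-! ### `Q ≠ 0 ⟺ c₀ ≠ 0` and the identity under the hypothesis `c₀ ≠ 0` -/

section C0

variable (b : Fin 3 → ℝ) (x₁ x₂ : ℂ)

/-- `c₀ = Re A₀ = Q/D` (pairwise-distinct `b`). [cite: Zhang2022LandauSiegel, §7 Prop. 7.1 p.44, (7.19)–(7.21)] -/
theorem re_atomA0_eq_dblQ_div (h01 : b 0 ≠ b 1) (h02 : b 0 ≠ b 2) (h12 : b 1 ≠ b 2) :
    ((atomA0 b).re : ℂ) = dblQ b / dblD b := by
  have hD := dblD_ne_zero b h01 h02 h12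
  rw [re_atomA0_closed b h01 h02 h12]
  unfold dblQ
  field_simp

/-- `c₀ ≠ 0 ⇒ Q ≠ 0` (pairwise-distinct `b`). [cite: Zhang2022LandauSiegel, §7 Prop. 7.1 p.44, (7.19)–(7.21)] -/
theorem dblQ_ne_zero_of_re_atomA0_ne_zero (h01 : b 0 ≠ b 1) (h02 : b 0 ≠ b 2) (h12 : b 1 ≠ b 2)
    (hc : (atomA0 b).re ≠ 0) : dblQ b ≠ 0 := by
  intro hQ
  apply hc
  have h := re_atomA0_eq_dblQ_div b h01 h02 h12
  rw [hQ, zero_div] at h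
  exact_mod_cast h

/-- **THE DOUBLING IDENTITY under `c₀ ≠ 0`** (the form K6 consumes: at a sign-admissible `b`, `c₀ > 0` is the tree's
`Det.re_sum_shiftW_pos`). [cite: Zhang2022LandauSiegel, §2 (2.32)–(2.33); §7 Prop. 7.1 p.44; §8 (8.11)–(8.18)] -/
theorem doublingIdentity_clamped_of_re_ne_zero (h01 : b 0 ≠ b 1) (h02 : b 0 ≠ b 2) (h12 : b 1 ≠ b 2)
    (hc : (atomA0 b).re ≠ 0) :
    (atomA0 b).re *
        bulkFormOn b 0 1 (extremal b (clampedCoeff b x₁ x₂)) (extremalD b (clampedCoeff b x₁ x₂))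
          (extremalDD b (clampedCoeff b x₁ x₂)) = freeEndForm b x₁ x₂ :=
  doublingIdentity_clamped b x₁ x₂ h01 h02 h12 (dblQ_ne_zero_of_re_atomA0_ne_zero b h01 h02 h12 hc)

/-- With `c₀ ≠ 0` the clamped extremal has the prescribed boundary data (all four conditions).
[cite: Zhang2022LandauSiegel, §7 Prop. 7.1 p.44] -/
theorem clampedExt_boundary_of_re_ne_zero (h01 : b 0 ≠ b 1) (h02 : b 0 ≠ b 2) (h12 : b 1 ≠ b 2)
    (hc : (atomA0 b).re ≠ 0) :
    extremal b (clampedCoeff b x₁ x₂) 0 = 0 ∧ extremalD b (clampedCoeff b x₁ x₂) 0 = 0 ∧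
      extremal b (clampedCoeff b x₁ x₂) 1 = x₁ ∧ extremalD b (clampedCoeff b x₁ x₂) 1 = x₂ :=
  have hQ := dblQ_ne_zero_of_re_atomA0_ne_zero b h01 h02 h12 hc
  ⟨clampedExt_zero b x₁ x₂ hQ, clampedExtD_zero b x₁ x₂ hQ, clampedExt_one b x₁ x₂ hQ, clampedExtD_one b x₁ x₂ hQ⟩

end C0

/-! ### Part 2 (append): continuity of the extremals, by name (for K3's `ContinuousOn` interface / K6) -/

section Continuity

variable (b : Fin 3 → ℝ) (γ : Fin 4 → ℂ)

/-- `F` is continuous. [cite: Zhang2022LandauSiegel, §7 Prop. 7.1 p.44] -/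
theorem continuous_extremal : Continuous (extremal b γ) :=
  continuous_iff_continuousAt.2 fun t => (hasDerivAt_extremal b γ t).continuousAt

/-- `F′` is continuous. [cite: Zhang2022LandauSiegel, §7 Prop. 7.1 p.44] -/
theorem continuous_extremalD : Continuous (extremalD b γ) :=
  continuous_iff_continuousAt.2 fun t => (hasDerivAt_extremalD b γ t).continuousAt

/-- `F″` is continuous. [cite: Zhang2022LandauSiegel, §7 Prop. 7.1 p.44] -/
theorem continuous_extremalDD : Continuous (extremalDD b γ) :=
  continuous_iff_continuousAt.2 fun t => (hasDerivAt_extremalDD b γ t).continuousAt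

/-- `F‴` is continuous. [cite: Zhang2022LandauSiegel, §7 Prop. 7.1 p.44] -/
theorem continuous_extremalDDD : Continuous (extremalDDD b γ) :=
  continuous_iff_continuousAt.2 fun t => (hasDerivAt_extremalDDD b γ t).continuousAt

/-- Right-derivatives on the open piece, in K3's two-piece shape. [cite: Zhang2022LandauSiegel, §7 Prop. 7.1 p.44] -/
theorem hasDerivWithinAt_extremal_Ioi (t : ℝ) :
    HasDerivWithinAt (extremal b γ) (extremalD b γ t) (Set.Ioi t) t :=
  (hasDerivAt_extremal b γ t).hasDerivWithinAt

/-- Right-derivatives of `F′` on the open piece. [cite: Zhang2022LandauSiegel, §7 Prop. 7.1 p.44] -/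
theorem hasDerivWithinAt_extremalD_Ioi (t : ℝ) :
    HasDerivWithinAt (extremalD b γ) (extremalDD b γ t) (Set.Ioi t) t :=
  (hasDerivAt_extremalD b γ t).hasDerivWithinAt

end Continuity

end Det

end Literature.NumberTheory.LFunctions.Zhang2022
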